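import Literature.AlgebraicGeometry.Modules.PullbackAffineChart
import Literature.AlgebraicGeometry.Modules.PullbackClosedImmersionUnitIso
import Literature.AlgebraicGeometry.Morphisms.SectionsBaseChangeSurjective
import Literature.AlgebraicGeometry.Morphisms.CechModule
import Mathlib.AlgebraicGeometry.Morphisms.ClosedImmersion
import HarnessLib

/-!
# [OURS · L1 W4.5(b) · T-P1VB part 1] Sections of the restriction `j^*M` of a quasi-coherent module to a
# closed subscheme, over an affine open: `Γ(j⁻¹V, j^*M) = Γ(V, M) / 𝒦(V) Γ(V, M)`

Cell res-hironaka, LADDER-RESOLUTION rung L (D-0089), slot W4.5(b), crux `Theses.EquisingularLift.EquisingularLiftNat`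
(stmt-ResolutionOfSingularities-20038) and its `n = 3` child `EquisingularLiftNatThree` (stmt-ResolutionOfSingularities-20148);
object **T-P1VB** (res-L1-w45b-lead-2 BOOK 2026-08-27T09:28:20Z, rung v8 DIR₀ of LEAD-MEMO-5: «sub-line-bundle lift on ℙ¹_O»),
`--supports stmt-ResolutionOfSingularities-20148 --as helper`. NOT a statement of any manuscript; OURS plumbing for the
H⁰-LIFTING route of the v8 supplier («Ȟ¹(ℙ¹_k, F_k) = 0 ⇒ Γ(ℙ¹_O, F) → Γ(ℙ¹_k, F_k) onto»). AI-written; AI review is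
weaker than expert review.

WHAT. For a closed immersion `j : Y → X`, an affine open `V ⊆ X` and an affine-localizing (e.g. quasi-coherent) `𝒪_X`-module
`M`, the pulled-back-section map `Γ(V, M) → Γ(j⁻¹V, j^*M)`, `m ↦ η(m)` (tree `Modules.unitSection`), is
* SURJECTIVE (`unitSection_surjective`), and
* has KERNEL `𝒦(V) · Γ(V, M)`, `𝒦(V) = ker (Γ(V, 𝒪_X) → Γ(j⁻¹V, 𝒪_Y))` (`unitSection_eq_zero_iff`),
i.e. `Γ(j⁻¹V, j^*M) = Γ(V, M) ⊗_{Γ(V)} Γ(j⁻¹V) = Γ(V, M)/𝒦(V)Γ(V, M)` (The Stacks Project, Tag 01I8 / 08KS: `i_*i^*𝓕 = 𝓕/𝓘𝓕`),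
through the tree's affine chart computation `Modules/PullbackAffineChart.unitSectionLE_eq_comp` (`Γ(U, f^*M) = Γ(U) ⊗_{Γ(V)} Γ(V, M)`)
and the algebra of `P → C ⊗_B P` for a surjection `B → C` (`one_tmul_surjective_of_surjective`,
`one_tmul_eq_zero_iff_of_surjective`). For the BASE CHANGE `g : X ×_A B → X` of a surjection `φ : A → B` along
`f : X → Spec A` (a closed immersion, `isClosedImmersion_of_isPullback`) the kernel is `(ker φ) · Γ(W, M)` as an `A`-submodule of
the tree's `MSections f M W` (`unitSection_eq_zero_iff_mem_smul_top`, via `Morphisms/SectionsBaseChangeSurjective`), and the map is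
onto (`unitSection_surjective_of_isPullback`). Part 2 (`…P1VBLiftSection`) runs Nakayama on the two-chart Čech complex with these.

References (index only): The Stacks Project, Tags 01I8, 08KS, 01QY; Hartshorne, *Algebraic Geometry* II Prop. 5.2; tree
`Modules/PullbackClosedImmersionUnitIso` (the `𝒦M = 0` case, whose pattern this file follows).
-/

noncomputable section

-- `TopCat.Presheaf`/`Scheme.Modules` are not reducible (as in Mathlib's `AlgebraicGeometry/Modules`).
set_option backward.isDefEq.respectTransparency false

open CategoryTheory AlgebraicGeometry Limits TopologicalSpace Opposite TensorProduct
open scoped ChangeOfRings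
open Literature.AlgebraicGeometry.Modules Literature.AlgebraicGeometry.Morphisms

universe u

set_option linter.dupNamespace false -- mandated namespace `Summit.<Summit>.<Problem>` of this single-conjunct summit

namespace Summit.ResolutionOfSingularities.ResolutionOfSingularities.Cruxes.EquisingularLiftNat.P1VB

/-! ### Algebra: `P → C ⊗_B P` for a surjection `ψ : B → C`: surjective, kernel `(ker ψ) P` -/

section Algebra

variable {B C : Type u} [CommRing B] [CommRing C] (ψ : B →+* C) (P : ModuleCat.{u} B)

/-- **`p ↦ 1 ⊗ p : P → C ⊗_B P` is surjective for `ψ : B → C` surjective**: `c ⊗ p = ψ(b) ⊗ p = 1 ⊗ b p`.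
[folklore] -/
theorem one_tmul_surjective_of_surjective (hψ : Function.Surjective ψ) :
    Function.Surjective
      (fun p : P => ((1 : C) ⊗ₜ[B, ψ] p : (ModuleCat.extendScalars.{u, u, u} ψ).obj P)) := by
  intro x
  induction x using TensorProduct.induction_on with
  | zero => exact ⟨0, by simp only [TensorProduct.tmul_zero]⟩
  | tmul c p =>
    obtain ⟨b, rfl⟩ := hψ c
    exact ⟨b • p, (map_tmul_eq_one_tmul_smul ψ P b p).symm⟩
  | add x y hx hy =>
    obtain ⟨p, hp⟩ := hx
    obtain ⟨p', hp'⟩ := hy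
    exact ⟨p + p', by simp only [TensorProduct.tmul_add, hp, hp']⟩

/-- **`1 ⊗ p = 0` in `C ⊗_B P` iff `p ∈ (ker ψ) P`**, for `ψ : B → C` surjective (`C ⊗_B P = P/(ker ψ)P`).
[folklore] -/
theorem one_tmul_eq_zero_iff_of_surjective (hψ : Function.Surjective ψ) (p : P) :
    ((1 : C) ⊗ₜ[B, ψ] p : (ModuleCat.extendScalars.{u, u, u} ψ).obj P) = 0 ↔
      p ∈ RingHom.ker ψ • (⊤ : Submodule B P) := by
  letI : Module B C := Module.compHom C ψ
  set K : Submodule B P := RingHom.ker ψ • (⊤ : Submodule B P) with hK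
  constructor
  · -- the map `c ⊗ p ↦ σ(c) p mod K P` for a set-theoretic section `σ` of `ψ`
    set σ : C → B := fun c => (hψ c).choose with hσ
    have hσψ : ∀ c, ψ (σ c) = c := fun c => (hψ c).choose_spec
    have hwd : ∀ (b b' : B), ψ b = ψ b' → ∀ q : P,
        (Submodule.mkQ K (b • q) : P ⧸ K) = Submodule.mkQ K (b' • q) := by
      intro b b' h q
      rw [← sub_eq_zero, ← map_sub, ← sub_smul, Submodule.mkQ_apply, Submodule.Quotient.mk_eq_zero]
      exact Submodule.smul_mem_smul (by rw [RingHom.mem_ker, map_sub, h, sub_self]) Submodule.mem_top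
    let g₂ : C →ₗ[B] P →ₗ[B] P ⧸ K :=
      LinearMap.mk₂ B (fun c q => Submodule.mkQ K (σ c • q))
        (fun c c' q => by
          change Submodule.mkQ K (σ (c + c') • q) = Submodule.mkQ K (σ c • q) + Submodule.mkQ K (σ c' • q)
          rw [← map_add, ← add_smul]
          exact hwd _ _ (by rw [hσψ, map_add, hσψ, hσψ]) q)
        (fun b c q => by
          change Submodule.mkQ K (σ (ψ b * c) • q) = b • Submodule.mkQ K (σ c • q)
          rw [← map_smul, ← mul_smul]
          exact hwd _ _ (by rw [hσψ, map_mul, hσψ]) q)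
        (fun c q q' => by
          change Submodule.mkQ K (σ c • (q + q')) = Submodule.mkQ K (σ c • q) + Submodule.mkQ K (σ c • q')
          rw [smul_add, map_add])
        (fun b c q => by
          change Submodule.mkQ K (σ c • b • q) = b • Submodule.mkQ K (σ c • q)
          rw [← map_smul, smul_comm])
    let g : TensorProduct B C P →ₗ[B] P ⧸ K := TensorProduct.lift g₂
    have hg : ∀ (c : C) (q : P),
        g (show TensorProduct B C P from (c ⊗ₜ[B, ψ] q : (ModuleCat.extendScalars.{u, u, u} ψ).obj P)) =
          Submodule.mkQ K (σ c • q) := fun c q =>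
      TensorProduct.lift.tmul c q
    intro h
    have h1 := congrArg (fun x : (ModuleCat.extendScalars.{u, u, u} ψ).obj P =>
      g (show TensorProduct B C P from x)) h
    simp only [hg, map_zero] at h1
    rw [hwd (σ 1) 1 (by rw [hσψ, map_one]) p, one_smul, Submodule.mkQ_apply,
      Submodule.Quotient.mk_eq_zero] at h1
    exact h1
  · intro hp
    refine Submodule.smul_induction_on hp (fun b hb q _ => ?_) (fun x y hx hy => ?_)
    · change ((1 : C) ⊗ₜ[B, ψ] (b • q) : (ModuleCat.extendScalars.{u, u, u} ψ).obj P) = 0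
      rw [← map_tmul_eq_one_tmul_smul ψ P b q, RingHom.mem_ker.mp hb, TensorProduct.zero_tmul]
    · rw [TensorProduct.tmul_add, hx, hy, add_zero]

end Algebra

/-! ### Sections of `j^*M` over `j⁻¹V`, `V` affine, `j` a closed immersion -/

section ClosedImmersion

variable {X Y : Scheme.{u}} (j : Y ⟶ X) (M : X.Modules)

/-- The unit at `V` is `unitSectionLE` for the identity inclusion `j⁻¹V ≤ j⁻¹V`. [folklore] -/
theorem unitSection_eq_unitSectionLE (V : X.Opens) (m : Γ(M, V)) :
    unitSection j M V m = unitSectionLE j M (le_refl (j ⁻¹ᵁ V)) m := by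
  change unitSection j M V m = ((Scheme.Modules.pullback j).obj M).presheaf.map (homOfLE _).op _
  rw [presheaf_map_congr _ (homOfLE (le_refl (j ⁻¹ᵁ V))) (𝟙 _), op_id, CategoryTheory.Functor.map_id]
  rfl

variable [IsClosedImmersion j]

/-- **`Γ(V, M) → Γ(j⁻¹V, j^*M)`, `m ↦ η(m)`, is SURJECTIVE** for `j` a closed immersion, `V` affine and
`M` affine-localizing (quasi-coherent): `Γ(j⁻¹V, j^*M) = Γ(j⁻¹V, 𝒪) ⊗_{Γ(V, 𝒪)} Γ(V, M)` and
`Γ(V, 𝒪) → Γ(j⁻¹V, 𝒪)` is onto. [folklore] -/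
theorem unitSection_surjective (hM : IsAffineLocalizing M) {V : X.Opens} (hV : IsAffineOpen V) :
    Function.Surjective (unitSection j M V) := by
  have hU : IsAffineOpen (j ⁻¹ᵁ V) := hV.preimage j
  have heq : unitSection j M V = unitSectionLE j M (le_refl (j ⁻¹ᵁ V)) :=
    funext (unitSection_eq_unitSectionLE j M V)
  rw [heq, unitSectionLE_eq_comp j M hV hU (le_refl _) hM]
  have hψ : chartHom j (le_refl (j ⁻¹ᵁ V)) = j.app V := (Scheme.Hom.app_eq_appLE j).symm
  refine (chartSectionsEquiv j M hV hU (le_refl _) hM).surjective.comp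
    (Function.Surjective.comp ?_ (appTopRestrictFromSpecEquiv M hV).surjective)
  exact one_tmul_surjective_of_surjective (chartHom j (le_refl (j ⁻¹ᵁ V))).hom (restrictTop M hV)
    (by rw [hψ]; exact j.app_surjective V hV)

/-- **`η(m) = 0` in `Γ(j⁻¹V, j^*M)` iff `m ∈ 𝒦(V) Γ(V, M)`**, `𝒦(V) = ker (Γ(V, 𝒪_X) → Γ(j⁻¹V, 𝒪_Y))`,
for `j` a closed immersion, `V` affine and `M` affine-localizing. [folklore] -/
theorem unitSection_eq_zero_iff (hM : IsAffineLocalizing M) {V : X.Opens} (hV : IsAffineOpen V)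
    (m : Γ(M, V)) :
    unitSection j M V m = 0 ↔ m ∈ RingHom.ker (j.app V).hom • (⊤ : Submodule Γ(X, V) Γ(M, V)) := by
  have hU : IsAffineOpen (j ⁻¹ᵁ V) := hV.preimage j
  rw [unitSection_eq_unitSectionLE, unitSectionLE_eq_comp j M hV hU (le_refl _) hM]
  have hψ : chartHom j (le_refl (j ⁻¹ᵁ V)) = j.app V := (Scheme.Hom.app_eq_appLE j).symm
  simp only [Function.comp_apply]
  rw [map_eq_zero_iff _ (chartSectionsEquiv j M hV hU (le_refl _) hM).injective]
  refine (one_tmul_eq_zero_iff_of_surjective (chartHom j (le_refl (j ⁻¹ᵁ V))).hom (restrictTop M hV)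
    (by rw [hψ]; exact j.app_surjective V hV) _).trans ?_
  -- transport along the `Γ(V)`-linear equivalence `Γ(V, M) ≃ Γ(M|_{Spec Γ(V)}, ⊤)`
  set e := appTopRestrictFromSpecEquiv M hV with he
  have hmap : (RingHom.ker (j.app V).hom • (⊤ : Submodule Γ(X, V) Γ(M, V))).map e.toLinearMap =
      RingHom.ker (chartHom j (le_refl (j ⁻¹ᵁ V))).hom • (⊤ : Submodule Γ(X, V) (restrictTop M hV)) := by
    rw [Submodule.map_smul'', Submodule.map_top, LinearMap.range_eq_top.mpr e.surjective, hψ]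
  constructor
  · intro h
    have h' : e m ∈ (RingHom.ker (j.app V).hom • (⊤ : Submodule Γ(X, V) Γ(M, V))).map e.toLinearMap := by
      rw [hmap]; exact h
    obtain ⟨m', hm', hmm'⟩ := h'
    rwa [← e.injective hmm']
  · intro h
    have h' : e m ∈ (RingHom.ker (j.app V).hom • (⊤ : Submodule Γ(X, V) Γ(M, V))).map e.toLinearMap :=
      ⟨m, h, rfl⟩
    rw [hmap] at h'
    exact h'

end ClosedImmersion

/-! ### Base change along a surjection `A → B`: `η(m) = 0 ⟺ m ∈ (ker φ) Γ(W, M)` -/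

section BaseChange

variable {A B : Type u} [CommRing A] [CommRing B] (φ : A →+* B)
  {X Y : Scheme.{u}} (f : X ⟶ Spec (.of A)) {g : Y ⟶ X} {t : Y ⟶ Spec (.of B)}

/-- The base change `g : Y = X ×_A B → X` of `Spec B → Spec A`, `A → B` surjective, is a closed immersion.
[folklore] -/
theorem isClosedImmersion_of_isPullback (hφ : Function.Surjective φ)
    (H : IsPullback g t f (Spec.map (CommRingCat.ofHom φ))) : IsClosedImmersion g :=
  haveI : IsClosedImmersion (Spec.map (CommRingCat.ofHom φ)) :=
    IsClosedImmersion.spec_of_surjective _ hφ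
  MorphismProperty.of_isPullback H.flip (inferInstance : IsClosedImmersion (Spec.map (CommRingCat.ofHom φ)))

/-- **`Γ(W, M) → Γ(g⁻¹W, g^*M)` is onto** over an affine `W`, for the base change `g` of a surjection
`A → B` and `M` affine-localizing. [folklore] -/
theorem unitSection_surjective_of_isPullback (hφ : Function.Surjective φ)
    (H : IsPullback g t f (Spec.map (CommRingCat.ofHom φ))) (M : X.Modules) (hM : IsAffineLocalizing M)
    {W : X.Opens} (hW : IsAffineOpen W) : Function.Surjective (unitSection g M W) :=
  haveI := isClosedImmersion_of_isPullback φ f hφ H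
  unitSection_surjective g M hM hW

/-- **`η(m) = 0` in `Γ(g⁻¹W, g^*M)` iff `m ∈ (ker φ) · Γ(W, M)`** (as an `A`-submodule of `Γ(W, M)`,
`A` acting through `f`), for the base change `g` of a surjection `φ : A → B` along `f : X → Spec A`,
`W ⊆ X` affine and `M` affine-localizing: the kernel of `Γ(W, 𝒪_X) → Γ(g⁻¹W, 𝒪_Y)` is
`(ker φ) Γ(W, 𝒪_X)` (tree `Morphisms/SectionsBaseChangeSurjective`). [folklore] -/
theorem unitSection_eq_zero_iff_mem_smul_top (hφ : Function.Surjective φ)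
    (H : IsPullback g t f (Spec.map (CommRingCat.ofHom φ))) (M : X.Modules) (hM : IsAffineLocalizing M)
    {W : X.Opens} (hW : IsAffineOpen W) (m : MSections f M W) :
    unitSection g M W m = 0 ↔ m ∈ RingHom.ker φ • (⊤ : Submodule A (MSections f M W)) := by
  haveI := isClosedImmersion_of_isPullback φ f hφ H
  rw [unitSection_eq_zero_iff g M hM hW]
  have hK : RingHom.ker (g.app W).hom = (RingHom.ker φ).map (algebraMap A (Sections f W)) := by
    ext b
    exact app_eq_zero_iff_mem_map_ker φ f hφ H hW b
  have h2 : ((RingHom.ker φ).map (algebraMap A (Sections f W)) •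
      (⊤ : Submodule (Sections f W) (MSections f M W))).restrictScalars A =
        RingHom.ker φ • (⊤ : Submodule A (MSections f M W)) := by
    rw [Ideal.smul_restrictScalars, Submodule.restrictScalars_top]
  rw [hK, ← h2]
  exact Iff.rfl

end BaseChange

end Summit.ResolutionOfSingularities.ResolutionOfSingularities.Cruxes.EquisingularLiftNat.P1VB

end
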